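import Summits.HodgeConjecture.HodgeConjecture.Theorems.SixfoldTableXCensusWeilRow20AllMembers
import Literature.AlgebraicGeometry.HodgeTheory.WeilTypeFourfoldTimesCMCurveSquaredBlockDataCentral
import Literature.AlgebraicGeometry.VanGeemen1994.WeilTypeEndFieldOfRankTwo
import Literature.AlgebraicGeometry.HodgeTheory.RankOneCentreTimesCMCurveProductSpan
import HarnessLib

/-!
# TABLE X (dimension 6) — ROW 20 `g6.E²xY4.(3,1)` (`A ∼ Y₄ × E_K²`), EVERY MEMBER, v2: the census re-key of
# `SixfoldTableXCensusWeilRow20AllMembers` with the tied socket's colour ∕ tie data, `Φ` central, `Y` simple and `Y` non-CM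
# DERIVED (eng-2 g8's E1a ∕ E1b `CMCurveSqFourfold.hG_of_hodgeLieC`; van Geemen 6.9 ∕ 6.11) — member data of record only
# (cell `pub-hodgeav-hg6`, req-37 (A) Q2b; eng-5 g7, brick R20-C v2; lead g4 2026-08-29T10:09Z ∕ 10:37Z)

HONEST FRAMING. HC, `HC_AV` (stmt-1333), `HC_CM` (stmt-3052) and H2 are NOT proved and do not occur. X2 ∕ X1 stay `@[conjecture]`
(OURS); `WeilSixfolds` (stmt-HodgeConjecture-2524), R-W6 and Markman₆ (preprint, unrefereed) appear only as displayed hypotheses of §2.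
KERNEL ONLY: theorems over existing declarations; no definition, no `sorry`, no named fact; restates nothing; a NEW file (the v1 file
`SixfoldTableXCensusWeilRow20AllMembers` is at the 400-line cap).

WHAT CHANGES w.r.t. v1: the binders `hYs`, `hYcm`, `hφC` and the thirteen colour ∕ tie data of the tied socket (`φE`, `μ`, `hinj`, `hKle`,
`hKge`, `S`, `hS1`, `k₀`, `hk₀`, `hW₀`, `hσ`, `hEndU`, `hEndT`) are GONE: `hG` comes from eng-2 g8's package
`CMCurveSqFourfold.hG_of_hodgeLieC` (`WeilTypeFourfoldTimesCMCurveSquaredBlockDataCentral`, E1b, over E1a's constructed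
`φ_E = diag(φ_Y, diag(2χ, 3χ))`) fed with R20-AV's Lie theorem `hodgeLieC_fourfold_prod_cmCurveSq_of_threeOne`; `Y` simple and not of
CM type from `finrank_ℚ End⁰(Y) = 2` (`VanGeemen1994.isSimple_of_finrank_endAlgebra_eq_two`, `…not_isOfCMType_of_finrank_endAlgebra_eq_two`);
`Φ` central from `CMCurveSqFourfold.comp_comm_diagonal`; `finrank_ℚ End⁰(E) = 2` (needed by E1b) from `dim E = 1` and `χ ≫ χ = −d`
(`finrank_endAlgebra_eq_two_of_cmCurve`, `isOfCMType_of_cmCurve`; lead g4 2026-08-29T11:04Z). NO datum is added: binders = member-defining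
data + class data only.

MEMBER DATA OF RECORD (row 20, v2, at the product `Y × (E × E)`): `dim Y = 4`, `finrank_ℚ End⁰(Y) = 2`, `φ_Y ≫ φ_Y = −d`, multiplicity
`3` or `1` at `i√d`; `dim E = 1`, `χ ≫ χ = −d`; the diagonal `Φ₂`, `Φ`; `Φ` of Weil type `(3, d)`; a rational
class `h` with a Kähler multiple and `hφQ`. Typed ≠ proved.

## References
* [MoonenZarhin1999LowDim] B. Moonen, Yu. Zarhin, Math. Ann. 315 (1999), Thm. 0.2, §2 (2.3), §5 (5.11).
* [Milne1999LefschetzClasses] J. S. Milne, Duke Math. J. 96 (1999), Thm. 3.2 and Cor. 4.5.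
* [vanGeemen1994HodgeAV] B. van Geemen, LNM 1594 (1994), 6.9, Thm. 6.11, 6.12, Lemma 3.7.
* [Deligne1982HodgeCycles] P. Deligne, LNM 900 (1982), I §3 Prop. 3.4 and 3.6.
-/

set_option linter.dupNamespace false

noncomputable section

open scoped TensorProduct
open CategoryTheory CategoryTheory.Limits
open Literature.AlgebraicGeometry Literature.AlgebraicGeometry.Motives
open Literature.AlgebraicGeometry.Motives.AbelianVariety
open Literature.AlgebraicGeometry.Motives.HodgeStructure
open Literature.AlgebraicGeometry.HodgeTheory
open Literature.AlgebraicGeometry.Milne1999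
open Literature.AlgebraicGeometry.Deligne1982 (isOfHodgeType_one_one_of_isKaehlerClass_smul)
open Literature.AlgebraicGeometry.VanGeemen1994 (pullbackOne hodgeGroupOne detOnEigenspace hodgeClassSpan
  isSimple_of_finrank_endAlgebra_eq_two not_isOfCMType_of_finrank_endAlgebra_eq_two)
open Literature.AlgebraicTopology.SingularHomology
open Literature.Barriers.HodgeConjecture
open Literature.Geometry.Kaehler (HasHardLefschetzProperty)
open Summit.HodgeConjecture.HodgeConjecture.Ring2.ClassTargets
open Summit.HodgeConjecture.HodgeConjecture.Ring2.Motiv (ProdCMCell)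
open Summit.HodgeConjecture.HodgeConjecture.Ring2.Atlas (IsQuarticFieldTypeIVFourfold)

namespace Summit.HodgeConjecture.HodgeConjecture.TableX.WeilERows

variable {Y E : AbelianVariety ℂ} {h : complexBetti (Y.prod (E.prod E)).X 2}


/-- Class data of the census: a rational class `h` with a Kähler multiple lies in `B¹ ⊗ ℂ` and its pairing `Q_h` on `H¹` is
non-degenerate (hard Lefschetz). Plumbing shared by the four theorems below. [folklore] -/
private theorem R20v2.classData {A : AbelianVariety ℂ} {φ : A ⟶ A} {d : ℕ} (hW : IsWeilType A φ 3 d) {h : complexBetti A.X 2}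
    (hQ : IsRationalClass h) (hK : ∃ s : ℝ, 0 < s ∧ IsKaehlerClass A.dim A.X ((s : ℂ) • h)) :
    h ∈ hodgeClassSpan A.dim A.X 1 ∧
      ∀ x : complexBetti A.X 1, (∀ y, polarizationPairingOne A.X h (A.dim - 1) x y = 0) → x = 0 := by
  have hX : IsSmoothProjective A.dim A.X := AbelianVariety.isSmoothProjective_holds
  obtain ⟨s, hs, hsK⟩ := hK
  have h11 : IsOfHodgeType A.dim A.X (2 * 1) 1 1 h := isOfHodgeType_one_one_of_isKaehlerClass_smul ⟨s, hs.ne', hsK⟩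
  refine ⟨Submodule.subset_span ⟨hQ, h11⟩, fun x hx => ?_⟩
  have hHL : HasHardLefschetzProperty h A.dim := by
    have h1 := HasHardLefschetzProperty.smul
      (hsK.hasHardLefschetzProperty hX fun _ ↦ Motives.hasHardLefschetzProperty_kaehlerClass_holds)
      (inv_ne_zero (Complex.ofReal_ne_zero.2 hs.ne'))
    rwa [smul_smul, inv_mul_cancel₀ (Complex.ofReal_ne_zero.2 hs.ne'), one_smul] at h1
  exact eq_zero_of_forall_polarizationPairingOne_eq_zero_of_hasHardLefschetzProperty (by rw [hW.dim_eq]; norm_num) hHL hx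

/-! ## §0 The group hypothesis `hG` of L18 at `Y₄ × E_K²`, member data only -/

/-- **`hG` FOR ROW 20 AT THE PRODUCT `Y₄ × E_K²`** (see the module docstring): R20-AV's Lie theorem fed into eng-2 g8's package
`CMCurveSqFourfold.hG_of_hodgeLieC` (colour ∕ tie data and `Φ` central derived there); `h` a rational class with a Kähler multiple
for which `Φ^*` is a `d`-similitude. Member data of record only. HC NOT proved.
[cite: MoonenZarhin1999LowDim, §2 (2.3) and §5 (5.11)] [cite: Deligne1982HodgeCycles, I §3 Prop. 3.4 and 3.6] -/
theorem hG_of_fourfold_prod_cmCurveSq'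
    (hY4 : Y.dim = 4) (φY : Y ⟶ Y) {d : ℕ} (hd : 0 < d) (hφY : φY ≫ φY = -(d • 𝟙 Y))
    (hE2 : Module.finrank ℚ Y.endAlgebra = 2)
    (h31 : eigenMultiplicity Y φY (Complex.I * (Real.sqrt d : ℂ)) = 3 ∨ eigenMultiplicity Y φY (Complex.I * (Real.sqrt d : ℂ)) = 1)
    (hE1 : E.dim = 1) (χ : E ⟶ E) (hχ : χ ≫ χ = -(d • 𝟙 E))
    (Φ₂ : E.prod E ⟶ E.prod E) (hΦ₂a : Φ₂ ≫ fst E E = fst E E ≫ χ) (hΦ₂b : Φ₂ ≫ snd E E = snd E E ≫ χ)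
    (Φ : Y.prod (E.prod E) ⟶ Y.prod (E.prod E)) (hΦ₁ : Φ ≫ fst Y (E.prod E) = fst Y (E.prod E) ≫ φY)
    (hΦ₂ : Φ ≫ snd Y (E.prod E) = snd Y (E.prod E) ≫ Φ₂)
    (hW : IsWeilType (Y.prod (E.prod E)) Φ 3 d)
    (hQ : IsRationalClass h) (hK : ∃ s : ℝ, 0 < s ∧ IsKaehlerClass (Y.prod (E.prod E)).dim (Y.prod (E.prod E)).X ((s : ℂ) • h))
    (hφQ : ∀ x y, polarizationPairingOne (Y.prod (E.prod E)).X h ((Y.prod (E.prod E)).dim - 1)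
        (pullbackOne (Y.prod (E.prod E)) Φ x) (pullbackOne (Y.prod (E.prod E)) Φ y) =
      (d : ℂ) • polarizationPairingOne (Y.prod (E.prod E)).X h ((Y.prod (E.prod E)).dim - 1) x y) :
    ∀ (u : complexBetti (Y.prod (E.prod E)).X 1 ≃ₗ[ℂ] complexBetti (Y.prod (E.prod E)).X 1)
      (hu : u ∈ unitaryCentralizerGroup (Y.prod (E.prod E)) h),
      detOnEigenspace u (pullbackOne (Y.prod (E.prod E)) Φ) (fun x ↦ (mem_centralizerGroup_iff.1 hu.1) Φ x)
        (Complex.I * (Real.sqrt d : ℂ)) = 1 → u ∈ hodgeGroupOne (Y.prod (E.prod E)).dim (Y.prod (E.prod E)).X := by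
  haveI : HodgeTensorFacts.{0, 0} := hodgeTensorFacts_holds
  obtain ⟨ψ⟩ := BettiUniverse.hodge_isPolarizable exists_isReal_hodgeModel_holds
    (AbelianVariety.isSmoothProjective_holds (A := Y.prod (E.prod E))) 1
  obtain ⟨hh, hnd⟩ := R20v2.classData hW hQ hK
  -- the Lie statement in the socket's antecedent shape (3)
  have hSU := hodgeLieC_fourfold_prod_cmCurveSq_of_threeOne hY4 φY hd hφY hE2 h31 hE1 χ hχ Φ₂ hΦ₂a hΦ₂b Φ hΦ₁ hΦ₂ hW ψ
  exact CMCurveSqFourfold.hG_of_hodgeLieC hY4 φY hd hφY hE2 hE1 χ hχ Φ₂ hΦ₂a hΦ₂b Φ hΦ₁ hΦ₂ hW ψ hSU hh hnd hφQ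

/-! ## §1 Row 20, every member: the census at the product and on its isogeny class, `hG` discharged -/

/-- **TABLE X ROW 20 `g6.E²xY4.(3,1)` — EVERY MEMBER, KERNEL VERDICT WITH DOMAIN MEMBERSHIP AT THE PRODUCT `Y₄ × E_K²`, NO Hodge-group
hypothesis displayed**: L18's `census_weilType_detOne_general_prod_prod` at `A := Y × (E × E)` with `hG` DISCHARGED by §0 and `φ^* ∈ C(A) ⊗ ℂ`
from the centrality of `Φ`. `Y` simple non-CM (binders of L18's domain clause). Conclusion `(dim = 6 ∧ ¬ 𝒞) ∧` X2 `∧` X1 at `Y × E²`.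
«Special members = ∅» for row 20. HC NOT proved. [cite: MoonenZarhin1999LowDim, Thm. 0.2, §2 (2.3), §5 (5.11)]
[cite: Milne1999LefschetzClasses, Thm. 3.2 and Cor. 4.5] [cite: vanGeemen1994HodgeAV, Thm. 6.12 and 4.9] -/
theorem census_row20_fourfold_prod_cmCurveSq'
    (hY4 : Y.dim = 4) (φY : Y ⟶ Y) {d : ℕ} (hd : 0 < d) (hφY : φY ≫ φY = -(d • 𝟙 Y))
    (hE2 : Module.finrank ℚ Y.endAlgebra = 2)
    (h31 : eigenMultiplicity Y φY (Complex.I * (Real.sqrt d : ℂ)) = 3 ∨ eigenMultiplicity Y φY (Complex.I * (Real.sqrt d : ℂ)) = 1)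
    (hE1 : E.dim = 1) (χ : E ⟶ E) (hχ : χ ≫ χ = -(d • 𝟙 E))
    (Φ₂ : E.prod E ⟶ E.prod E) (hΦ₂a : Φ₂ ≫ fst E E = fst E E ≫ χ) (hΦ₂b : Φ₂ ≫ snd E E = snd E E ≫ χ)
    (Φ : Y.prod (E.prod E) ⟶ Y.prod (E.prod E)) (hΦ₁ : Φ ≫ fst Y (E.prod E) = fst Y (E.prod E) ≫ φY)
    (hΦ₂ : Φ ≫ snd Y (E.prod E) = snd Y (E.prod E) ≫ Φ₂)
    (hW : IsWeilType (Y.prod (E.prod E)) Φ 3 d)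
    (hQ : IsRationalClass h) (hK : ∃ s : ℝ, 0 < s ∧ IsKaehlerClass (Y.prod (E.prod E)).dim (Y.prod (E.prod E)).X ((s : ℂ) • h))
    (hφQ : ∀ x y, polarizationPairingOne (Y.prod (E.prod E)).X h ((Y.prod (E.prod E)).dim - 1)
        (pullbackOne (Y.prod (E.prod E)) Φ x) (pullbackOne (Y.prod (E.prod E)) Φ y) =
      (d : ℂ) • polarizationPairingOne (Y.prod (E.prod E)).X h ((Y.prod (E.prod E)).dim - 1) x y) :
    ((Y.prod (E.prod E)).dim = 6 ∧
      ¬ (IsOfCMType (Y.prod (E.prod E)) ∨ ProdCMCell IsQuarticFieldTypeIVFourfold (fun Z ↦ Z.dim = 2) (Y.prod (E.prod E)))) ∧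
    (∀ c : complexBetti (Y.prod (E.prod E)).X (2 * 2), IsRationalClass c →
      IsOfHodgeType (Y.prod (E.prod E)).dim (Y.prod (E.prod E)).X (2 * 2) 2 2 c →
      c ∈ divisorClassesSpan (Y.prod (E.prod E)).X (Y.prod (E.prod E)).dim 2 ⊔
        Submodule.span ℂ {w' : complexBetti (Y.prod (E.prod E)).X (2 * 2) |
        ∃ (C : AbelianVariety ℂ) (g : (Y.prod (E.prod E)).X ⟶ C.X) (w : complexBetti C.X (2 * 2)), C.dim < (Y.prod (E.prod E)).dim ∧
          IsRationalClass w ∧ IsOfHodgeType C.dim C.X (2 * 2) 2 2 w ∧ w' = complexBetti.map g (2 * 2) w}) ∧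
    (∀ c : complexBetti (Y.prod (E.prod E)).X (2 * 3), IsRationalClass c →
      IsOfHodgeType (Y.prod (E.prod E)).dim (Y.prod (E.prod E)).X (2 * 3) 3 3 c →
      c ∈ divisorClassesSpan (Y.prod (E.prod E)).X (Y.prod (E.prod E)).dim 3 ⊔
        Submodule.span ℂ {w' : complexBetti (Y.prod (E.prod E)).X (2 * 3) |
          ∃ (a : complexBetti (Y.prod (E.prod E)).X (2 * 2)) (b : complexBetti (Y.prod (E.prod E)).X (2 * 1)),
            IsRationalClass a ∧ IsOfHodgeType (Y.prod (E.prod E)).dim (Y.prod (E.prod E)).X (2 * 2) 2 2 a ∧ IsRationalClass b ∧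
            IsOfHodgeType (Y.prod (E.prod E)).dim (Y.prod (E.prod E)).X (2 * 1) 1 1 b ∧ w' = cupProduct (two_mul_add_two_mul 2 1) a b} ⊔
        Submodule.span ℂ {w' : complexBetti (Y.prod (E.prod E)).X (2 * 3) |
          ∃ (C : AbelianVariety ℂ) (g : (Y.prod (E.prod E)).X ⟶ C.X) (w : complexBetti C.X (2 * 3)), C.dim < (Y.prod (E.prod E)).dim ∧
            IsRationalClass w ∧ IsOfHodgeType C.dim C.X (2 * 3) 3 3 w ∧ w' = complexBetti.map g (2 * 3) w} ⊔
        Submodule.span ℂ {w' : complexBetti (Y.prod (E.prod E)).X (2 * 3) |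
          ∃ (B' : AbelianVariety ℂ) (g : (Y.prod (E.prod E)).X ⟶ B'.X) (d : ℕ) (ψ : B' ⟶ B') (w : complexBetti B'.X (2 * 3)),
            B'.dim = 6 ∧ 0 < d ∧ ψ ≫ ψ = -(d • 𝟙 B') ∧ IsRationalClass w ∧
            IsOfHodgeType B'.dim B'.X (2 * 3) 3 3 w ∧ w ∈ weilClassesOf B' ψ 3 d ∧
            w' = complexBetti.map g (2 * 3) w}) := by
  haveI : HodgeTensorFacts.{0, 0} := hodgeTensorFacts_holds
  have hYs : Y.IsSimple := isSimple_of_finrank_endAlgebra_eq_two (by omega) hd hφY hE2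
  have hYcm : ¬ IsOfCMType Y := not_isOfCMType_of_finrank_endAlgebra_eq_two (by omega) hd hφY hE2
  have hEE : Module.finrank ℚ E.endAlgebra = 2 := finrank_endAlgebra_eq_two_of_cmCurve hE1 (isOfCMType_of_cmCurve hE1 hd hχ)
  have hφC : ∀ θ : Y.prod (E.prod E) ⟶ Y.prod (E.prod E), θ ≫ Φ = Φ ≫ θ :=
    CMCurveSqFourfold.comp_comm_diagonal hYs (by omega) (by omega) hd hφY hE2 (by omega) hχ hEE hΦ₂a hΦ₂b hΦ₁ hΦ₂
  have h0Y : 0 < Y.dim := by omega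
  have hY : Y.dim ≠ 4 ∨ Module.finrank ℚ Y.endAlgebra ≠ 4 := Or.inr (by omega)
  have hCs : E.IsSimple := AbelianVariety.isSimple_of_dim_le_one hE1.le
  have h0C : 0 < E.dim := by omega
  have hC4 : E.dim < 4 := by omega
  -- `h` is a rational `(1,1)`-class with non-degenerate `Q_h`
  obtain ⟨hh, hnd⟩ := R20v2.classData hW hQ hK
  have hφC' : pullbackOne (Y.prod (E.prod E)) Φ ∈ centralizerAlgebra (Y.prod (E.prod E)) :=
    pullbackOne_mem_centralizerAlgebra_of_comp_comm hφC
  exact census_weilType_detOne_general_prod_prod (Y.prod (E.prod E)) Φ d hYs hYcm h0Y hY hCs h0C hC4 hCs h0C hC4 (IsIsogenous.refl _)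
    hW hh hnd hφC' hφQ
    (hG_of_fourfold_prod_cmCurveSq' hY4 φY hd hφY hE2 h31 hE1 χ hχ Φ₂ hΦ₂a hΦ₂b Φ hΦ₁ hΦ₂ hW hQ hK hφQ)

/-- **Row 20, every member `A ∼ Y₄ × E_K²`** (L18's `…_of_isIsogenous` with `hG` discharged and the domain membership from
`not_residueClass_of_isIsogenous_prod_prod`): the census verdict on the whole isogeny class of the product. HC NOT proved.
[cite: MoonenZarhin1999LowDim, Thm. 0.2 and §5 (5.1), (5.11)] [cite: Milne1999LefschetzClasses, Thm. 3.2 and Cor. 4.5]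
[cite: vanGeemen1994HodgeAV, Lemma 3.7 and Thm. 6.12] -/
theorem census_row20_of_isIsogenous_fourfold_prod_cmCurveSq' {A' : AbelianVariety ℂ}
    (hY4 : Y.dim = 4) (φY : Y ⟶ Y) {d : ℕ} (hd : 0 < d) (hφY : φY ≫ φY = -(d • 𝟙 Y))
    (hE2 : Module.finrank ℚ Y.endAlgebra = 2)
    (h31 : eigenMultiplicity Y φY (Complex.I * (Real.sqrt d : ℂ)) = 3 ∨ eigenMultiplicity Y φY (Complex.I * (Real.sqrt d : ℂ)) = 1)
    (hE1 : E.dim = 1) (χ : E ⟶ E) (hχ : χ ≫ χ = -(d • 𝟙 E))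
    (Φ₂ : E.prod E ⟶ E.prod E) (hΦ₂a : Φ₂ ≫ fst E E = fst E E ≫ χ) (hΦ₂b : Φ₂ ≫ snd E E = snd E E ≫ χ)
    (Φ : Y.prod (E.prod E) ⟶ Y.prod (E.prod E)) (hΦ₁ : Φ ≫ fst Y (E.prod E) = fst Y (E.prod E) ≫ φY)
    (hΦ₂ : Φ ≫ snd Y (E.prod E) = snd Y (E.prod E) ≫ Φ₂)
    (hW : IsWeilType (Y.prod (E.prod E)) Φ 3 d)
    (hQ : IsRationalClass h) (hK : ∃ s : ℝ, 0 < s ∧ IsKaehlerClass (Y.prod (E.prod E)).dim (Y.prod (E.prod E)).X ((s : ℂ) • h))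
    (hφQ : ∀ x y, polarizationPairingOne (Y.prod (E.prod E)).X h ((Y.prod (E.prod E)).dim - 1)
        (pullbackOne (Y.prod (E.prod E)) Φ x) (pullbackOne (Y.prod (E.prod E)) Φ y) =
      (d : ℂ) • polarizationPairingOne (Y.prod (E.prod E)).X h ((Y.prod (E.prod E)).dim - 1) x y)
    (hA'A : IsIsogenous A' (Y.prod (E.prod E))) :
    (A'.dim = 6 ∧ ¬ (IsOfCMType A' ∨ ProdCMCell IsQuarticFieldTypeIVFourfold (fun Z ↦ Z.dim = 2) A')) ∧
    (∀ c : complexBetti A'.X (2 * 2), IsRationalClass c → IsOfHodgeType A'.dim A'.X (2 * 2) 2 2 c →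
      c ∈ divisorClassesSpan A'.X A'.dim 2 ⊔ Submodule.span ℂ {w' : complexBetti A'.X (2 * 2) |
        ∃ (C : AbelianVariety ℂ) (g : A'.X ⟶ C.X) (w : complexBetti C.X (2 * 2)), C.dim < A'.dim ∧
          IsRationalClass w ∧ IsOfHodgeType C.dim C.X (2 * 2) 2 2 w ∧ w' = complexBetti.map g (2 * 2) w}) ∧
    (∀ c : complexBetti A'.X (2 * 3), IsRationalClass c → IsOfHodgeType A'.dim A'.X (2 * 3) 3 3 c →
      c ∈ divisorClassesSpan A'.X A'.dim 3 ⊔ Submodule.span ℂ {w' : complexBetti A'.X (2 * 3) |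
          ∃ (a : complexBetti A'.X (2 * 2)) (b : complexBetti A'.X (2 * 1)),
            IsRationalClass a ∧ IsOfHodgeType A'.dim A'.X (2 * 2) 2 2 a ∧ IsRationalClass b ∧
            IsOfHodgeType A'.dim A'.X (2 * 1) 1 1 b ∧ w' = cupProduct (two_mul_add_two_mul 2 1) a b} ⊔
        Submodule.span ℂ {w' : complexBetti A'.X (2 * 3) |
          ∃ (C : AbelianVariety ℂ) (g : A'.X ⟶ C.X) (w : complexBetti C.X (2 * 3)), C.dim < A'.dim ∧
            IsRationalClass w ∧ IsOfHodgeType C.dim C.X (2 * 3) 3 3 w ∧ w' = complexBetti.map g (2 * 3) w} ⊔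
        Submodule.span ℂ {w' : complexBetti A'.X (2 * 3) |
          ∃ (B' : AbelianVariety ℂ) (g : A'.X ⟶ B'.X) (d : ℕ) (ψ : B' ⟶ B') (w : complexBetti B'.X (2 * 3)),
            B'.dim = 6 ∧ 0 < d ∧ ψ ≫ ψ = -(d • 𝟙 B') ∧ IsRationalClass w ∧
            IsOfHodgeType B'.dim B'.X (2 * 3) 3 3 w ∧ w ∈ weilClassesOf B' ψ 3 d ∧
            w' = complexBetti.map g (2 * 3) w}) := by
  haveI : HodgeTensorFacts.{0, 0} := hodgeTensorFacts_holds
  have hYs : Y.IsSimple := isSimple_of_finrank_endAlgebra_eq_two (by omega) hd hφY hE2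
  have hYcm : ¬ IsOfCMType Y := not_isOfCMType_of_finrank_endAlgebra_eq_two (by omega) hd hφY hE2
  have hEE : Module.finrank ℚ E.endAlgebra = 2 := finrank_endAlgebra_eq_two_of_cmCurve hE1 (isOfCMType_of_cmCurve hE1 hd hχ)
  have hφC : ∀ θ : Y.prod (E.prod E) ⟶ Y.prod (E.prod E), θ ≫ Φ = Φ ≫ θ :=
    CMCurveSqFourfold.comp_comm_diagonal hYs (by omega) (by omega) hd hφY hE2 (by omega) hχ hEE hΦ₂a hΦ₂b hΦ₁ hΦ₂
  have h0Y : 0 < Y.dim := by omega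
  have hY : Y.dim ≠ 4 ∨ Module.finrank ℚ Y.endAlgebra ≠ 4 := Or.inr (by omega)
  have hCs : E.IsSimple := AbelianVariety.isSimple_of_dim_le_one hE1.le
  have h0C : 0 < E.dim := by omega
  have hC4 : E.dim < 4 := by omega
  obtain ⟨hh, hnd⟩ := R20v2.classData hW hQ hK
  have hφC' : pullbackOne (Y.prod (E.prod E)) Φ ∈ centralizerAlgebra (Y.prod (E.prod E)) :=
    pullbackOne_mem_centralizerAlgebra_of_comp_comm hφC
  have hdom := not_residueClass_of_isIsogenous_prod_prod hYs hYcm h0Y hY hCs h0C hC4 hCs h0C hC4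
    (IsIsogenous.refl (Y.prod (E.prod E)))
  exact census_weilType_detOne_general_of_isIsogenous (Y.prod (E.prod E)) Φ d hW hdom hh hnd hφC' hφQ
    (hG_of_fourfold_prod_cmCurveSq' hY4 φY hd hφY hE2 h31 hE1 χ hχ Φ₂ hΦ₂a hΦ₂b Φ hΦ₁ hΦ₂ hW hQ hK hφQ) hA'A

/-! ## §2 HC at every row-20 member ⟸ the DISPLAYED residue binders -/

/-- **HC for every `A ∼ Y₄ × E_K²` of row 20 ⟸ the ladder item `WeilSixfolds` (stmt-HodgeConjecture-2524, DISPLAYED, not asserted)** —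
L18's no-domain `hodgeConjectureFor_weilType_detOne_general_of_weilSixfolds` at the product with `hG` discharged, transported along the
isogeny. HC NOT proved unconditionally. [cite: vanGeemen1994HodgeAV, 2.4, Lemma 3.7 and Thm. 6.12] [cite: Milne1999LefschetzClasses, Cor. 4.5]
[cite: MoonenZarhin1999LowDim, Thm. 0.2 and §5 (5.11)] -/
theorem hodgeConjectureFor_of_isIsogenous_row20_of_weilSixfolds' {A' : AbelianVariety ℂ}
    (hW₆ : Theses.SevenfoldWeilCensus.WeilSixfolds)
    (hY4 : Y.dim = 4) (φY : Y ⟶ Y) {d : ℕ} (hd : 0 < d) (hφY : φY ≫ φY = -(d • 𝟙 Y))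
    (hE2 : Module.finrank ℚ Y.endAlgebra = 2)
    (h31 : eigenMultiplicity Y φY (Complex.I * (Real.sqrt d : ℂ)) = 3 ∨ eigenMultiplicity Y φY (Complex.I * (Real.sqrt d : ℂ)) = 1)
    (hE1 : E.dim = 1) (χ : E ⟶ E) (hχ : χ ≫ χ = -(d • 𝟙 E))
    (Φ₂ : E.prod E ⟶ E.prod E) (hΦ₂a : Φ₂ ≫ fst E E = fst E E ≫ χ) (hΦ₂b : Φ₂ ≫ snd E E = snd E E ≫ χ)
    (Φ : Y.prod (E.prod E) ⟶ Y.prod (E.prod E)) (hΦ₁ : Φ ≫ fst Y (E.prod E) = fst Y (E.prod E) ≫ φY)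
    (hΦ₂ : Φ ≫ snd Y (E.prod E) = snd Y (E.prod E) ≫ Φ₂)
    (hW : IsWeilType (Y.prod (E.prod E)) Φ 3 d)
    (hQ : IsRationalClass h) (hK : ∃ s : ℝ, 0 < s ∧ IsKaehlerClass (Y.prod (E.prod E)).dim (Y.prod (E.prod E)).X ((s : ℂ) • h))
    (hφQ : ∀ x y, polarizationPairingOne (Y.prod (E.prod E)).X h ((Y.prod (E.prod E)).dim - 1)
        (pullbackOne (Y.prod (E.prod E)) Φ x) (pullbackOne (Y.prod (E.prod E)) Φ y) =
      (d : ℂ) • polarizationPairingOne (Y.prod (E.prod E)).X h ((Y.prod (E.prod E)).dim - 1) x y)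
    (hA'A : IsIsogenous A' (Y.prod (E.prod E))) : HodgeConjectureFor A'.dim A'.X := by
  haveI : HodgeTensorFacts.{0, 0} := hodgeTensorFacts_holds
  have hYs : Y.IsSimple := isSimple_of_finrank_endAlgebra_eq_two (by omega) hd hφY hE2
  have hEE : Module.finrank ℚ E.endAlgebra = 2 := finrank_endAlgebra_eq_two_of_cmCurve hE1 (isOfCMType_of_cmCurve hE1 hd hχ)
  have hφC : ∀ θ : Y.prod (E.prod E) ⟶ Y.prod (E.prod E), θ ≫ Φ = Φ ≫ θ :=
    CMCurveSqFourfold.comp_comm_diagonal hYs (by omega) (by omega) hd hφY hE2 (by omega) hχ hEE hΦ₂a hΦ₂b hΦ₁ hΦ₂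
  obtain ⟨hh, hnd⟩ := R20v2.classData hW hQ hK
  have hφC' : pullbackOne (Y.prod (E.prod E)) Φ ∈ centralizerAlgebra (Y.prod (E.prod E)) :=
    pullbackOne_mem_centralizerAlgebra_of_comp_comm hφC
  exact HodgeConjectureFor.of_isIsogenous hA'A
    (hodgeConjectureFor_weilType_detOne_general_of_weilSixfolds (Y.prod (E.prod E)) Φ d hW₆ hW hh hnd hφC' hφQ
      (hG_of_fourfold_prod_cmCurveSq' hY4 φY hd hφY hE2 h31 hE1 χ hχ Φ₂ hΦ₂a hΦ₂b Φ hΦ₁ hΦ₂ hW hQ hK hφQ))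

/-- **HC for every `A ∼ Y₄ × E_K²` of row 20 ⟸ the NAMED RESIDUES {Markman₆ (preprint, unrefereed), R-W6} (DISPLAYED, not asserted)** —
L18's `hodgeConjectureFor_of_isIsogenous_weilType_detOne_general_of_markman₆_nonsplit` with `hG` discharged. HC NOT proved
unconditionally. [cite: Markman2025SecantWeil, Thm. 1.5.1 (preprint, unrefereed)] [cite: vanGeemen1994HodgeAV, Lemma 3.7 and Thm. 6.12]
[cite: Milne1999LefschetzClasses, Cor. 4.5] -/
theorem hodgeConjectureFor_of_isIsogenous_row20_of_markman₆_nonsplit' {A' : AbelianVariety ℂ}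
    (hMark₆ : Markman2025_weilClasses_algebraic_hyperbolicSixfold) (hRW6 : WeilTypeLadder.NonsplitSixfolds)
    (hY4 : Y.dim = 4) (φY : Y ⟶ Y) {d : ℕ} (hd : 0 < d) (hφY : φY ≫ φY = -(d • 𝟙 Y))
    (hE2 : Module.finrank ℚ Y.endAlgebra = 2)
    (h31 : eigenMultiplicity Y φY (Complex.I * (Real.sqrt d : ℂ)) = 3 ∨ eigenMultiplicity Y φY (Complex.I * (Real.sqrt d : ℂ)) = 1)
    (hE1 : E.dim = 1) (χ : E ⟶ E) (hχ : χ ≫ χ = -(d • 𝟙 E))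
    (Φ₂ : E.prod E ⟶ E.prod E) (hΦ₂a : Φ₂ ≫ fst E E = fst E E ≫ χ) (hΦ₂b : Φ₂ ≫ snd E E = snd E E ≫ χ)
    (Φ : Y.prod (E.prod E) ⟶ Y.prod (E.prod E)) (hΦ₁ : Φ ≫ fst Y (E.prod E) = fst Y (E.prod E) ≫ φY)
    (hΦ₂ : Φ ≫ snd Y (E.prod E) = snd Y (E.prod E) ≫ Φ₂)
    (hW : IsWeilType (Y.prod (E.prod E)) Φ 3 d)
    (hQ : IsRationalClass h) (hK : ∃ s : ℝ, 0 < s ∧ IsKaehlerClass (Y.prod (E.prod E)).dim (Y.prod (E.prod E)).X ((s : ℂ) • h))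
    (hφQ : ∀ x y, polarizationPairingOne (Y.prod (E.prod E)).X h ((Y.prod (E.prod E)).dim - 1)
        (pullbackOne (Y.prod (E.prod E)) Φ x) (pullbackOne (Y.prod (E.prod E)) Φ y) =
      (d : ℂ) • polarizationPairingOne (Y.prod (E.prod E)).X h ((Y.prod (E.prod E)).dim - 1) x y)
    (hA'A : IsIsogenous A' (Y.prod (E.prod E))) : HodgeConjectureFor A'.dim A'.X := by
  haveI : HodgeTensorFacts.{0, 0} := hodgeTensorFacts_holds
  have hYs : Y.IsSimple := isSimple_of_finrank_endAlgebra_eq_two (by omega) hd hφY hE2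
  have hEE : Module.finrank ℚ E.endAlgebra = 2 := finrank_endAlgebra_eq_two_of_cmCurve hE1 (isOfCMType_of_cmCurve hE1 hd hχ)
  have hφC : ∀ θ : Y.prod (E.prod E) ⟶ Y.prod (E.prod E), θ ≫ Φ = Φ ≫ θ :=
    CMCurveSqFourfold.comp_comm_diagonal hYs (by omega) (by omega) hd hφY hE2 (by omega) hχ hEE hΦ₂a hΦ₂b hΦ₁ hΦ₂
  obtain ⟨hh, hnd⟩ := R20v2.classData hW hQ hK
  have hφC' : pullbackOne (Y.prod (E.prod E)) Φ ∈ centralizerAlgebra (Y.prod (E.prod E)) :=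
    pullbackOne_mem_centralizerAlgebra_of_comp_comm hφC
  exact hodgeConjectureFor_of_isIsogenous_weilType_detOne_general_of_markman₆_nonsplit (Y.prod (E.prod E)) Φ d hMark₆ hRW6 hW hh hnd
    hφC' hφQ
    (hG_of_fourfold_prod_cmCurveSq' hY4 φY hd hφY hE2 h31 hE1 χ hχ Φ₂ hΦ₂a hΦ₂b Φ hΦ₁ hΦ₂ hW hQ hK hφQ) hA'A

end Summit.HodgeConjecture.HodgeConjecture.TableX.WeilERows

end
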